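import Mathlib.Analysis.Convex.Combination
import Mathlib.Data.Real.Basic
import Mathlib.Data.Sign.Basic
import Mathlib.LinearAlgebra.AffineSpace.Independent
import Mathlib.Tactic.Abel
import Mathlib.Tactic.Linarith
import Mathlib.Tactic.Ring
import HarnessLib

/-!
# Sign arrangements of finitely many affine functionals: faces and closed faces

Elementary convex geometry of the *arrangement* cut out by a family `L : ι → E →ᵃ[ℝ] ℝ` of
affine functionals on a real vector space `E` (typically finitely many), phrased entirely
through **sign vectors** so that no face-lattice theory of polyhedra is needed:

* `svec L x : ι → SignType` — the sign vector `i ↦ sign (L i x)` of a point;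
* `face L ε` — the (relatively open) face `{x | svec L x = ε}`; faces partition `E`;
* `SLE ε' ε` — the face order: `ε'` arises from `ε` by zeroing some entries;
* `cl L ε = {x | SLE (svec L x) ε}` — the closed face: the solution set of the weak
  inequalities `L i ≥ 0` / `L i ≤ 0` / `L i = 0` prescribed by `ε` (`mem_cl_iff`); it is convex
  (`convex_cl`).

The two facts on which everything else rests:

* `combo_mem_face` — a convex combination with *positive* weight of a point of `face L ε` and a
  point of `cl L ε` lies in `face L ε`;
* `mem_face_of_lt` / `eq_of_mem_cl_diff_face` — consequently a ray issuing from a point of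
  `face L ε` meets `cl L ε \ face L ε` in at most one point ("uniqueness of the exit point").

This file is the first of three (`SignArrangementChains`: chains of faces and the uniqueness of
positive chain representations; `SignArrangementTriangulation`: the exit point exists when the
closed face is bounded, and the chain simplices form a geometric simplicial complex covering the
faces).  They are used in `Literature.Topology.FourManifolds.PLManifoldComp` to prove that
composites of piecewise-linear maps are piecewise linear (Rourke–Sanderson (1972), 2.14) without
developing subdivisions of cell complexes: the cells on which a composite `g ∘ f` of simplexwise
affine maps is affine are closed faces of such an arrangement.

All statements are standard (faces of hyperplane arrangements / covectors of realisable oriented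
matroids); we know of no single source stating them in this form and tag them `[folklore]`.
-/

open Set Function

noncomputable section

namespace Literature.Analysis.Convexity

namespace SignArrangement


variable {E : Type*} [AddCommGroup E] [Module ℝ E] {ι : Type*}

/-- The sign vector of a point `x` with respect to the family of affine functionals `L`:
`i ↦ sign (L i x)`. [folklore] -/
def svec (L : ι → E →ᵃ[ℝ] ℝ) (x : E) : ι → SignType := fun i => SignType.sign (L i x)

/-- The (relatively open) *face* of the arrangement with sign vector `ε`: the points whose sign
vector is exactly `ε`. [folklore] -/
def face (L : ι → E →ᵃ[ℝ] ℝ) (ε : ι → SignType) : Set E := {x | svec L x = ε}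

/-- The face order on sign vectors: `SLE ε' ε` ("`ε'` is below `ε`") iff `ε'` is obtained from `ε`
by replacing some entries by `0`. [folklore] -/
def SLE (ε' ε : ι → SignType) : Prop := ∀ i, ε' i = 0 ∨ ε' i = ε i

/-- The *closed face* with sign vector `ε`: the points whose sign vector is below `ε`, i.e. the
solution set of the weak inequalities `L i x ≥ 0` (`ε i = 1`), `L i x ≤ 0` (`ε i = -1`),
`L i x = 0` (`ε i = 0`). [folklore] -/
def cl (L : ι → E →ᵃ[ℝ] ℝ) (ε : ι → SignType) : Set E := {x | SLE (svec L x) ε}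

variable {L : ι → E →ᵃ[ℝ] ℝ} {ε ε' ε'' : ι → SignType} {x p q : E}

/-- Unfolding lemma for `face`. [folklore] -/
theorem mem_face_iff : x ∈ face L ε ↔ svec L x = ε := Iff.rfl

/-- Unfolding lemma for `cl`. [folklore] -/
theorem mem_cl_iff_sle : x ∈ cl L ε ↔ SLE (svec L x) ε := Iff.rfl

/-- Unfolding lemma for `svec`. [folklore] -/
theorem svec_apply (i : ι) : svec L x i = SignType.sign (L i x) := rfl

/-- Every point lies in the face of its own sign vector. [folklore] -/
theorem mem_face_svec (x : E) : x ∈ face L (svec L x) := rfl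

/-- The face order is reflexive. [folklore] -/
theorem SLE.refl (ε : ι → SignType) : SLE ε ε := fun _ => Or.inr rfl

/-- The face order is reflexive. [folklore] -/
theorem SLE.rfl : SLE ε ε := SLE.refl ε

/-- The face order is transitive. [folklore] -/
theorem SLE.trans (h₁ : SLE ε'' ε') (h₂ : SLE ε' ε) : SLE ε'' ε := fun i => by
  rcases h₁ i with h | h
  · exact Or.inl h
  · rcases h₂ i with h' | h'
    · exact Or.inl (h.trans h')
    · exact Or.inr (h.trans h')

/-- The face order is antisymmetric. [folklore] -/
theorem SLE.antisymm (h₁ : SLE ε' ε) (h₂ : SLE ε ε') : ε' = ε := by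
  funext i
  rcases h₁ i with h | h
  · rcases h₂ i with h' | h'
    · exact h.trans h'.symm
    · exact h'.symm
  · exact h

/-- Zero entries are inherited downwards in the face order. [folklore] -/
theorem SLE.apply_eq_zero (h : SLE ε' ε) {i : ι} (hi : ε i = 0) : ε' i = 0 := by
  rcases h i with h' | h'
  exacts [h', h'.trans hi]

/-- A face lies in its closed face. [folklore] -/
theorem face_subset_cl : face L ε ⊆ cl L ε := fun _ hx => hx ▸ SLE.rfl

/-- Closed faces are monotone in the face order. [folklore] -/
theorem cl_mono (h : SLE ε' ε) : cl L ε' ⊆ cl L ε := fun _ hx => SLE.trans hx h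

/-- Membership in a closed face, as a system of weak inequalities. [folklore] -/
theorem mem_cl_iff : x ∈ cl L ε ↔
    ∀ i, (ε i = 1 → 0 ≤ L i x) ∧ (ε i = -1 → L i x ≤ 0) ∧ (ε i = 0 → L i x = 0) := by
  refine forall_congr' fun i => ?_
  simp only [svec_apply]
  rcases lt_trichotomy (L i x) 0 with h | h | h
  · rw [sign_neg h]
    cases ε i <;> simp <;> first | exact h.le | exact h.ne | linarith
  · rw [h, sign_zero]
    cases ε i <;> simp
  · rw [sign_pos h]
    cases ε i <;> simp <;> first | exact h.le | exact h.ne' | linarith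

/-- A convex combination with positive weight of a point of the face `ε` with a point of the
closed face `ε` lies in the face `ε`. [folklore] -/
theorem combo_mem_face (hp : p ∈ face L ε) (hq : q ∈ cl L ε) {a b : ℝ} (ha : 0 < a)
    (hb : 0 ≤ b) (hab : a + b = 1) : a • p + b • q ∈ face L ε := by
  funext i
  have hpi : SignType.sign (L i p) = ε i := congr_fun hp i
  have hqi := (mem_cl_iff.1 hq) i
  rw [svec_apply, Convex.combo_affine_apply hab]
  simp only [smul_eq_mul]
  rcases hε : ε i with _ | _ | _
  · -- ε i = 0
    rw [hε] at hpi
    rw [sign_eq_zero_iff.1 hpi, hqi.2.2 hε, mul_zero, mul_zero, add_zero, sign_zero]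
    rfl
  · -- ε i = -1
    rw [hε] at hpi
    have := sign_eq_neg_one_iff.1 hpi
    exact sign_neg (by nlinarith [hqi.2.1 hε])
  · -- ε i = 1
    rw [hε] at hpi
    have := sign_eq_one_iff.1 hpi
    exact sign_pos (by nlinarith [hqi.1 hε])

/-- Closed faces are convex. [folklore] -/
theorem convex_cl (L : ι → E →ᵃ[ℝ] ℝ) (ε : ι → SignType) : Convex ℝ (cl L ε) := by
  intro x hx y hy a b ha hb hab
  rw [mem_cl_iff] at hx hy ⊢
  intro i
  rw [Convex.combo_affine_apply hab]
  simp only [smul_eq_mul]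
  refine ⟨fun h => ?_, fun h => ?_, fun h => ?_⟩
  · nlinarith [(hx i).1 h, (hy i).1 h]
  · nlinarith [(hx i).2.1 h, (hy i).2.1 h]
  · rw [(hx i).2.2 h, (hy i).2.2 h, mul_zero, mul_zero, add_zero]

/-- Along a line, an affine functional is affine in the parameter. [folklore] -/
theorem apply_add_smul (f : E →ᵃ[ℝ] ℝ) (p d : E) (t : ℝ) :
    f (p + t • d) = f p + t * f.linear d := by
  rw [add_comm p, ← vadd_eq_add, AffineMap.map_vadd, LinearMap.map_smul, vadd_eq_add, smul_eq_mul,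
    add_comm]

/-- On a segment from a point `p` of the face `ε`: if a later point `p + s₂ • d` of the ray lies
in the closed face, every earlier point `p + s₁ • d`, `0 < s₁ < s₂`, lies in the (open) face.
Hence the ray meets `cl L ε \ face L ε` in at most one point. [folklore] -/
theorem mem_face_of_lt (hp : p ∈ face L ε) {d : E} {s₁ s₂ : ℝ} (hs₁ : 0 < s₁) (hs : s₁ < s₂)
    (h₂ : p + s₂ • d ∈ cl L ε) : p + s₁ • d ∈ face L ε := by
  have hs₂ : 0 < s₂ := hs₁.trans hs
  have key := combo_mem_face hp h₂ (a := 1 - s₁ / s₂) (b := s₁ / s₂)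
    (by rw [sub_pos, div_lt_one hs₂]; exact hs) (div_nonneg hs₁.le hs₂.le) (by ring)
  convert key using 1
  rw [smul_add, smul_smul, div_mul_cancel₀ _ hs₂.ne', sub_smul, one_smul]
  abel

/-- A ray from a point of the face `ε` meets `cl L ε \ face L ε` in at most one point.
[folklore] -/
theorem eq_of_mem_cl_diff_face (hp : p ∈ face L ε) {d : E} {s₁ s₂ : ℝ} (hs₁ : 0 < s₁)
    (hs₂ : 0 < s₂) (h₁ : p + s₁ • d ∈ cl L ε \ face L ε) (h₂ : p + s₂ • d ∈ cl L ε \ face L ε) :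
    s₁ = s₂ := by
  rcases lt_trichotomy s₁ s₂ with h | h | h
  · exact (h₁.2 (mem_face_of_lt hp hs₁ h h₂.1)).elim
  · exact h
  · exact (h₂.2 (mem_face_of_lt hp hs₂ h h₁.1)).elim

/-- Affine independence is preserved by adjoining a point outside the affine span (set version
of Mathlib's `AffineIndependent.affineIndependent_of_notMem_span`). [folklore] -/
theorem affineIndependent_insert_of_notMem {S : Set E} {p : E}
    (hS : AffineIndependent ℝ ((↑) : S → E)) (hp : p ∉ affineSpan ℝ S) :
    AffineIndependent ℝ ((↑) : ↥(insert p S) → E) := by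
  let i : ↥(insert p S) := ⟨p, Set.mem_insert p S⟩
  refine AffineIndependent.affineIndependent_of_notMem_span (i := i) ?_ ?_
  · let f : {y : ↥(insert p S) // y ≠ i} ↪ S :=
      ⟨fun y => ⟨y.1.1, (Set.mem_insert_iff.1 y.1.2).resolve_left fun h => y.2 (Subtype.ext h)⟩,
        fun y y' h => Subtype.ext (Subtype.ext (congrArg (fun z : S => (z : E)) h))⟩
    exact hS.comp_embedding f
  · refine fun h => hp (affineSpan_mono ℝ ?_ h)
    rintro _ ⟨y, hy, rfl⟩
    exact (Set.mem_insert_iff.1 y.2).resolve_left fun h' => hy (Subtype.ext h')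

end SignArrangement

end Literature.Analysis.Convexity
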